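import Mathlib.LinearAlgebra.Matrix.ToLinearEquiv
import Mathlib.LinearAlgebra.Matrix.NonsingularInverse
import Literature.NumberTheory.Transcendental.RoySmallValueEstimatesRegularSeqProofs
import Literature.NumberTheory.Transcendental.RoySmallValueEstimatesResultantDegreeProofs
import Literature.NumberTheory.Transcendental.NesterenkoEliminationZerosK
import Literature.NumberTheory.Transcendental.NesterenkoEliminationProp47Proofs
import HarnessLib

/-!
# Small value estimates at rational translates (Nguyen–Roy 2016) — proofs, XIII: the determinant `Φ` and `deg Res_D = D^m`

Thirteenth proofs file towards `Literature.NumberTheory.Transcendental.nguyenRoy2016_thm_1` (Nguyen–Roy,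
IJNT 12 (2016) = arXiv:1412.5163). The engine of Roy's multiplicity estimate (Mathematika 59 (2013)
= arXiv:1301.0663 [R2013], proof of Theorem 5.2) is the polynomial map
`Φ : 𝐐 = (Q₀, …, Q_m) ↦ det M_𝐐`, the determinant of `φ_𝐐 : E₀ × ⋯ × E_m → ℂ[X]_ν`,
`(A_j) ↦ ∑ A_j Q_j`, for the subspaces `E_j` of Lemma 5.1 attached to a regular sequence
`P₀, …, P_m` of forms of degree `D` (`ν = (m+1)D − m`, `dim E_m = D^m`): `Φ` "is a multihomogeneous
polynomial map which is homogeneous of degree `D^m` in the last component", `Φ(P) ≠ 0`, and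
`Φ = Ψ · Res_D` "since the resultant is homogeneous of degree `D^m` on each factor". This file
builds `Φ` over `ℚ` for the regular sequence `x₀^D, …, x_m^D` (file XII) and PROVES all of this,
including the degree of the resultant:

* `NguyenRoy.decompE m D` — the `E_j` (file X, `exists_decomp_of_regular`), with bases `basisE`,
  `dimE_last : dim E_m = D^m`, and `card_colIdx : ∑ dim E_j = dim ℚ[x]_ν` (the isomorphism `φ_P`);
* `NguyenRoy.genMat`, **`NguyenRoy.detPhi hD = Φ ∈ ℚ[u]`** (`u_{i,j}` = coefficient of `x^{α_j}` in
  `Q_i`), with `coeff_Gvec` (under any specialisation `q`, `M(q) v` is the coefficient vector of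
  `∑ v_{jk} b_{jk} Q_j`), **`detPhi_ne_zero`** (`Φ(x₀^D,…,x_m^D) ≠ 0` by the uniqueness in Lemma 5.1),
  **`isWeightedHomogeneous_detPhi` / `blockDeg_detPhi : deg_{u_i} Φ = dim E_i`**;
* **`resD_dvd_detPhi : Res_D ∣ Φ`** — at the generic point `ū` of `Res_D = 0` (in an algebraic
  closure of `Frac(ℚ[u]/(Res_D))`) the forms `Q_ū` have a common projective zero (Nesterenko's zeros
  theorem over algebraically closed fields, `Nesterenko.aeval_chowForm_eq_zero_iff_of_isAlgClosed`,
  and the Veronese dictionary of file XI over any field, `exists_veroPt_of_zerosK`), so `φ_{Q_ū}`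
  misses `x_k^ν` and `Φ(ū) = 0`;
* **`ideg_veroIdeal_eq : deg 𝔙_D = D^m`** and **`blockDeg_resD_eq : deg_{u_i} Res_D = D^m`** for all
  `i` (`m ≥ 1`, `D ≥ 2`): `≤` from `Res_D ∣ Φ` and the block homogeneity of both (a monomial of `Φ`
  is a product of monomials of `Res_D` and `Ψ`), `≥` from file XII (`pow_le_ideg_veroIdeal`).

What Theorem 5.2 proper still needs beyond this file: the same construction for a regular sequence
`P₀, …, P_{m−1} ∈ I_D` (existence = the unmixedness input "the subspace `I_D` contains a regular
sequence of length `m`"), the rows adapted to `I_ν`, and the vanishing of the partial derivatives of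
`Φ` of order `< deg(I)` on `I_D^{m+1}`.

Definitions are the objects of the proof (with bodies); no named facts.

## References

* [Roy2013] D. Roy, *A small value estimate for 𝔾ₐ × 𝔾ₘ*, Mathematika 59 (2013) = arXiv:1301.0663,
  §5: Lemma 5.1, Theorem 5.2 and its proof (pp. 13–14 of the arXiv text).
* [NesterenkoPhilippon2001] Yu. V. Nesterenko, P. Philippon (eds.), LNM 1752 (2001), Ch. 3 §4,
  Def. 4.3–4.5, Prop. 4.4 (p. 38).
* [NguyenRoy2016] N. A. V. Nguyen, D. Roy, IJNT 12 (2016) = arXiv:1412.5163, §4 (which imports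
  R2013 §5).
-/

noncomputable section

open MvPolynomial Finset

attribute [local instance] MvPolynomial.gradedAlgebra

namespace Literature.NumberTheory.Transcendental

namespace NguyenRoy

attribute [local instance] fintypeMonoIdx

/-! ## R2013 Theorem 5.2's determinant `Φ` for the regular sequence `x₀^D, …, x_m^D` -/

section Phi

attribute [local instance] finiteDimensional_homogeneousSubmodule

variable (m D : ℕ)

/-- `ν = (m+1)D − m`, the degree in which Lemma 5.1 is applied. [cite: Roy2013, proof of Theorem 5.2] -/
def nuD : ℕ := (m + 1) * D - m

variable {m D} in
/-- `(m+1)D ≤ ν + m` and `D ≤ ν` for `D ≥ 1`. [folklore] -/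
theorem nuD_spec (hD : 1 ≤ D) : (m + 1) * D ≤ nuD m D + m ∧ D ≤ nuD m D := by
  have h1 : m + 1 ≤ (m + 1) * D := Nat.le_mul_of_pos_right _ hD
  have h2 : (m + 1) * D = m * D + D := by ring
  have h3 : m ≤ m * D := Nat.le_mul_of_pos_right _ hD
  unfold nuD
  omega

/-- The regularity of `x₀^D, …, x_m^D` in the form used by file X. [folklore] -/
theorem purePow_hreg : ∀ j ≤ m, ∀ F : Nesterenko.Rx m,
    purePow m D j * F ∈ idealUpTo (purePow (K := ℚ) m D) j →
      F ∈ idealUpTo (purePow (K := ℚ) m D) j :=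
  fun j hj F hF => purePow_regular m D j hj F hF

variable {m D} in
/-- Lemma 5.1 for `x₀^D, …, x_m^D` and `ν = (m+1)D − m`. [cite: Roy2013, Lemma 5.1] -/
theorem decomp_spec (hD : 1 ≤ D) :
    ∃ E : Fin (m + 1) → Submodule ℚ (Nesterenko.Rx m),
      (∀ j, E j ≤ homogeneousSubmodule (Fin (m + 1)) ℚ (nuD m D - D)) ∧
      Module.finrank ℚ (E (Fin.last m)) = D ^ m ∧
      ∀ F ∈ homogeneousSubmodule (Fin (m + 1)) ℚ (nuD m D),
        ∃! Q : Fin (m + 1) → Nesterenko.Rx m,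
          (∀ j : Fin (m + 1), Q j ∈ E j) ∧ ∑ j, Q j * purePow m D j = F :=
  exists_decomp_of_regular hD (purePow m D) (isHomogeneous_purePow m D) (purePow_hreg m D)
    (nuD_spec hD).1

/-- **The subspaces `E₀, …, E_m`** of Lemma 5.1 for `x₀^D, …, x_m^D`, chosen once and for all
(`⊥` in the degenerate case `D = 0`). [cite: Roy2013, proof of Theorem 5.2] -/
def decompE : Fin (m + 1) → Submodule ℚ (Nesterenko.Rx m) :=
  if h : 1 ≤ D then (decomp_spec (m := m) h).choose else fun _ => ⊥

variable {m D} in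
/-- The defining properties of `E₀, …, E_m`. [cite: Roy2013, Lemma 5.1] -/
theorem decompE_spec (hD : 1 ≤ D) :
    (∀ j, decompE m D j ≤ homogeneousSubmodule (Fin (m + 1)) ℚ (nuD m D - D)) ∧
      Module.finrank ℚ (decompE m D (Fin.last m)) = D ^ m ∧
      ∀ F ∈ homogeneousSubmodule (Fin (m + 1)) ℚ (nuD m D),
        ∃! Q : Fin (m + 1) → Nesterenko.Rx m,
          (∀ j : Fin (m + 1), Q j ∈ decompE m D j) ∧ ∑ j, Q j * purePow m D j = F := by
  rw [decompE, dif_pos hD]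
  exact (decomp_spec (m := m) hD).choose_spec

/-- `E_j ⊆ ℚ[x]_{ν−D}` (in all cases). [cite: Roy2013, Lemma 5.1] -/
theorem decompE_le (j : Fin (m + 1)) :
    decompE m D j ≤ homogeneousSubmodule (Fin (m + 1)) ℚ (nuD m D - D) := by
  by_cases hD : 1 ≤ D
  · exact (decompE_spec hD).1 j
  · rw [decompE, dif_neg hD]
    exact bot_le

/-- The `E_j` are finite-dimensional. [folklore] -/
instance finiteDimensional_decompE (j : Fin (m + 1)) : FiniteDimensional ℚ (decompE m D j) :=
  Submodule.finiteDimensional_of_le (decompE_le m D j)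

/-- `d_j = dim E_j`. [cite: Roy2013, proof of Theorem 5.2] -/
def dimE (j : Fin (m + 1)) : ℕ := Module.finrank ℚ (decompE m D j)

variable {m D} in
/-- `d_m = D^m`. [cite: Roy2013, Lemma 5.1] -/
theorem dimE_last (hD : 1 ≤ D) : dimE m D (Fin.last m) = D ^ m := (decompE_spec hD).2.1

/-- A basis of `E_j`. [folklore] -/
def basisE (j : Fin (m + 1)) : Module.Basis (Fin (dimE m D j)) ℚ (decompE m D j) :=
  Module.finBasis ℚ (decompE m D j)

/-- The column index: pairs `(j, k)`, `k < d_j` (the basis `𝒜` of `E₀ × ⋯ × E_m`).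
[cite: Roy2013, proof of Theorem 5.2] -/
abbrev ColIdx : Type := Σ j : Fin (m + 1), Fin (dimE m D j)

/-- The basis vectors `b_{j,k} ∈ E_j ⊆ ℚ[x]_{ν−D}` as polynomials. [folklore] -/
def bvec (c : ColIdx m D) : Nesterenko.Rx m := (basisE m D c.1 c.2 : Nesterenko.Rx m)

/-- `b_{j,k} ∈ E_j`. [folklore] -/
theorem bvec_mem (c : ColIdx m D) : bvec m D c ∈ decompE m D c.1 := (basisE m D c.1 c.2).2

/-- `b_{j,k} ∈ ℚ[x]_{ν−D}`. [folklore] -/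
theorem isHomogeneous_bvec (c : ColIdx m D) : (bvec m D c).IsHomogeneous (nuD m D - D) :=
  decompE_le m D c.1 (bvec_mem m D c)

variable {m D} in
/-- `∑ Q_j x_j^D ∈ ℚ[x]_ν` for `Q_j ∈ E_j`. [folklore] -/
theorem sum_mul_purePow_mem (hD : 1 ≤ D) (Q : (j : Fin (m + 1)) → decompE m D j) :
    ∑ j, (Q j : Nesterenko.Rx m) * purePow m D j ∈
      homogeneousSubmodule (Fin (m + 1)) ℚ (nuD m D) := by
  refine Submodule.sum_mem _ fun j _ => ?_
  have h := (decompE_le m D j (Q j).2 : ((Q j : Nesterenko.Rx m)).IsHomogeneous _).mul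
    (isHomogeneous_purePow (K := ℚ) m D j)
  rwa [Nat.sub_add_cancel (nuD_spec hD).2] at h

variable {m D} in
/-- **`∑ d_j = dim ℚ[x]_ν`**: the map `(Q_j) ↦ ∑ Q_j x_j^D` is an isomorphism `E₀ × ⋯ × E_m ≅ ℚ[x]_ν`
(Lemma 5.1), so the column and row index types have the same cardinality. [cite: Roy2013, proof of Theorem 5.2] -/
theorem card_colIdx (hD : 1 ≤ D) :
    Fintype.card (ColIdx m D) = Fintype.card (MonoIdx m (nuD m D)) := by
  classical
  obtain ⟨-, -, huniq⟩ := decompE_spec (m := m) hD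
  -- the linear map `(Q_j) ↦ ∑ Q_j P_j`
  let ψ₀ : ((j : Fin (m + 1)) → decompE m D j) →ₗ[ℚ] Nesterenko.Rx m :=
    ∑ j : Fin (m + 1), (LinearMap.mulRight ℚ (purePow m D j : Nesterenko.Rx m)).comp
      ((decompE m D j).subtype.comp (LinearMap.proj j))
  have hψ₀ : ∀ Q, ψ₀ Q = ∑ j, (Q j : Nesterenko.Rx m) * purePow m D j := fun Q => by
    simp [ψ₀, LinearMap.sum_apply]
  let ψ := LinearMap.codRestrict (homogeneousSubmodule (Fin (m + 1)) ℚ (nuD m D)) ψ₀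
    (fun Q => by rw [hψ₀]; exact sum_mul_purePow_mem hD Q)
  have hψ : ∀ Q, (ψ Q : Nesterenko.Rx m) = ∑ j, (Q j : Nesterenko.Rx m) * purePow m D j :=
    fun Q => by rw [LinearMap.codRestrict_apply, hψ₀]
  have hinj : Function.Injective ψ := by
    intro Q Q' h
    have h' := congrArg Subtype.val h
    rw [hψ, hψ] at h'
    have hu := (huniq _ (sum_mul_purePow_mem hD Q)).unique ⟨fun j => (Q j).2, rfl⟩
      ⟨fun j => (Q' j).2, h'.symm⟩
    funext j
    exact Subtype.ext (congrFun hu j)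
  have hsurj : Function.Surjective ψ := by
    rintro ⟨F, hF⟩
    obtain ⟨Q, ⟨hQ, hQF⟩, -⟩ := huniq F hF
    refine ⟨fun j => ⟨Q j, hQ j⟩, Subtype.ext ?_⟩
    rw [hψ]
    exact hQF
  have e := LinearEquiv.ofBijective ψ ⟨hinj, hsurj⟩
  have h1 := e.finrank_eq
  rw [Module.finrank_pi_fintype, finrank_homogeneousSubmodule_eq_choose] at h1
  rw [Fintype.card_sigma, card_monoIdx, ← h1]
  simp only [Fintype.card_fin]
  rfl

variable {m D} in
/-- An identification of the columns with the rows (monomials of degree `ν`). [folklore] -/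
def colEquiv (hD : 1 ≤ D) : ColIdx m D ≃ MonoIdx m (nuD m D) :=
  Fintype.equivOfCardEq (card_colIdx hD)

/-! ### The generic matrix and its determinant -/

/-- The entry of the generic matrix at row `γ` (a monomial of degree `ν`) and column `(j, k)`:
`∑_{j'} u_{j,j'} · [x^γ](b_{j,k} x^{α_{j'}})`, i.e. the `x^γ`-coefficient of `b_{j,k} · 𝐐_j` for the
generic form `𝐐_j = ∑_{j'} u_{j,j'} x^{α_{j'}}`. [cite: Roy2013, proof of Theorem 5.2] -/
def genEntry (γ : Fin (m + 1) →₀ ℕ) (c : ColIdx m D) : Nesterenko.RU (m + 1) (veroN m D) :=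
  ∑ j' : Fin (veroN m D + 1), C (coeff γ (bvec m D c * monomial (vexp m D j') 1)) * X (c.1, j')

variable {m D} in
/-- **The matrix `M_𝐐`** of `φ_𝐐 : E₀ × ⋯ × E_m → ℚ[x]_ν`, `(A_j) ↦ ∑ A_j 𝐐_j`, for the generic
forms `𝐐_j`, in the bases `(b_{j,k})` and `(x^γ)_{|γ| = ν}` (columns re-indexed by `colEquiv`).
[cite: Roy2013, proof of Theorem 5.2] -/
def genMat (hD : 1 ≤ D) :
    Matrix (MonoIdx m (nuD m D)) (MonoIdx m (nuD m D)) (Nesterenko.RU (m + 1) (veroN m D)) :=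
  fun γ ρ => genEntry m D γ.1 ((colEquiv hD).symm ρ)

variable {m D} in
/-- **`Φ = det M_𝐐 ∈ ℚ[u]`**, a polynomial in the coefficients of `m + 1` generic forms of degree
`D`. [cite: Roy2013, proof of Theorem 5.2] -/
def detPhi (hD : 1 ≤ D) : Nesterenko.RU (m + 1) (veroN m D) := (genMat hD).det

/-! ### Specialisation -/

section Spec

variable {L : Type*} [CommRing L]

/-- The specialised forms `Q_i = ∑_j q_{i,j} x^{α_j} ∈ L[x]_D`. [folklore] -/
def specForm (q : Fin (m + 1) × Fin (veroN m D + 1) → L) (i : Fin (m + 1)) :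
    MvPolynomial (Fin (m + 1)) L :=
  ∑ j', monomial (vexp m D j') (q (i, j'))

/-- `Q_i ∈ L[x]_D`. [folklore] -/
theorem isHomogeneous_specForm (q : Fin (m + 1) × Fin (veroN m D + 1) → L) (i : Fin (m + 1)) :
    (specForm m D q i).IsHomogeneous D :=
  IsHomogeneous.sum _ _ _ fun j' _ => isHomogeneous_monomial _ (degree_vexp m D j')

/-- `Q_i(x) = ∑_j q_{i,j} x^{α_j}`. [folklore] -/
theorem aeval_specForm (q : Fin (m + 1) × Fin (veroN m D + 1) → L) (i : Fin (m + 1))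
    (x : Fin (m + 1) → L) :
    aeval x (specForm m D q i) = ∑ j', q (i, j') * ∏ k, x k ^ vexp m D j' k := by
  rw [specForm, map_sum]
  refine Finset.sum_congr rfl fun j' _ => ?_
  rw [aeval_monomial, Algebra.algebraMap_self, RingHom.id_apply, Finsupp.prod_fintype]
  intro k
  rw [pow_zero]

/-- Coefficients of `(b ⊗ 1) · r x^α`. [folklore] -/
theorem coeff_map_mul_monomial (f : ℚ →+* L) (b : Nesterenko.Rx m) (α γ : Fin (m + 1) →₀ ℕ)
    (r : L) : coeff γ (map f b * monomial α r) = r * f (coeff γ (b * monomial α 1)) := by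
  rw [← coeff_map, map_mul, map_monomial, map_one,
    show monomial α r = C r * monomial α 1 by rw [C_mul_monomial, mul_one], mul_left_comm,
    coeff_C_mul]

variable {m D}

/-- The polynomial `G_v = ∑_ρ v_ρ · b_{c(ρ)} · Q_{c(ρ).1} ∈ L[x]_ν` represented by a column vector
`v`. [folklore] -/
def Gvec [Algebra ℚ L] (hD : 1 ≤ D) (q : Fin (m + 1) × Fin (veroN m D + 1) → L)
    (v : MonoIdx m (nuD m D) → L) : MvPolynomial (Fin (m + 1)) L :=
  ∑ ρ, v ρ • (map (algebraMap ℚ L) (bvec m D ((colEquiv hD).symm ρ)) *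
    specForm m D q ((colEquiv hD).symm ρ).1)

/-- `G_v ∈ L[x]_ν`. [folklore] -/
theorem isHomogeneous_Gvec [Algebra ℚ L] (hD : 1 ≤ D) (q : Fin (m + 1) × Fin (veroN m D + 1) → L)
    (v : MonoIdx m (nuD m D) → L) : (Gvec hD q v).IsHomogeneous (nuD m D) := by
  refine IsHomogeneous.sum _ _ _ fun ρ _ => ?_
  have h := ((isHomogeneous_bvec m D ((colEquiv hD).symm ρ)).map (algebraMap ℚ L)).mul
    (isHomogeneous_specForm m D q ((colEquiv hD).symm ρ).1)
  rw [Nat.sub_add_cancel (nuD_spec hD).2] at h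
  exact (homogeneousSubmodule (Fin (m + 1)) L (nuD m D)).smul_mem (v ρ) h

/-- **Coefficients of `G_v` are the entries of `M(q) v`**: `[x^γ] G_v = (M(q) v)_γ`.
[cite: Roy2013, proof of Theorem 5.2] -/
theorem coeff_Gvec [Algebra ℚ L] (hD : 1 ≤ D) (q : Fin (m + 1) × Fin (veroN m D + 1) → L)
    (v : MonoIdx m (nuD m D) → L) (γ : MonoIdx m (nuD m D)) :
    coeff γ.1 (Gvec hD q v) = ((genMat hD).map (aeval q)).mulVec v γ := by
  simp only [Matrix.mulVec, dotProduct, Matrix.map_apply, genMat, Gvec, coeff_sum, coeff_smul,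
    smul_eq_mul]
  refine Finset.sum_congr rfl fun ρ _ => ?_
  rw [genEntry, map_sum, specForm, Finset.mul_sum, coeff_sum, Finset.mul_sum, Finset.sum_mul]
  refine Finset.sum_congr rfl fun j' _ => ?_
  rw [map_mul, aeval_C, aeval_X, coeff_map_mul_monomial]
  ring

/-- A form is zero once its coefficients at all exponents of its degree vanish. [folklore] -/
theorem eq_zero_of_forall_coeff {n : ℕ} {H : MvPolynomial (Fin (m + 1)) L}
    (hH : H.IsHomogeneous n) (h : ∀ γ : MonoIdx m n, coeff γ.1 H = 0) : H = 0 := by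
  ext d
  rw [coeff_zero]
  by_cases hd : d.degree = n
  · exact h ⟨d, hd⟩
  · exact hH.coeff_eq_zero hd

/-- `G_v(x) = ∑_ρ v_ρ b_{c(ρ)}(x) Q_{c(ρ).1}(x)`; in particular `G_v(x) = 0` at a common zero of the
`Q_i`. [folklore] -/
theorem aeval_Gvec_eq_zero [Algebra ℚ L] (hD : 1 ≤ D) {q : Fin (m + 1) × Fin (veroN m D + 1) → L}
    {x : Fin (m + 1) → L} (hx : ∀ i, aeval x (specForm m D q i) = 0)
    (v : MonoIdx m (nuD m D) → L) : aeval x (Gvec hD q v) = 0 := by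
  rw [Gvec, map_sum]
  refine Finset.sum_eq_zero fun ρ _ => ?_
  rw [map_smul, map_mul, hx, mul_zero, smul_zero]

end Spec

/-! ### `Φ ≠ 0`: the specialisation at `x₀^D, …, x_m^D` -/

/-- The coefficient vector of `(x₀^D, …, x_m^D)`. [folklore] -/
def q0 (v : Fin (m + 1) × Fin (veroN m D + 1)) : ℚ :=
  if vexp m D v.2 = Finsupp.single v.1 D then 1 else 0

/-- The specialised forms at `q0` are the pure powers. [folklore] -/
theorem specForm_q0 (i : Fin (m + 1)) : specForm m D (q0 m D) i = X i ^ D := by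
  rw [specForm, X_pow_eq_monomial,
    Finset.sum_eq_single (vidx m D (Finsupp.single i D) (Finsupp.degree_single i D))]
  · rw [q0, vexp_vidx, if_pos rfl]
  · intro j _ hj
    rw [q0, if_neg, monomial_zero]
    intro h
    apply hj
    apply vexp_injective m D
    rw [vexp_vidx]
    exact h
  · intro h
    exact absurd (Finset.mem_univ _) h

variable {m D} in
/-- `x_i^D = purePow m D i` for `i : Fin (m+1)`. [folklore] -/
theorem purePow_fin (i : Fin (m + 1)) : (purePow m D i : Nesterenko.Rx m) = X i ^ D := by
  rw [purePow_of_lt m D i.isLt]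

variable {m D} in
/-- **`Φ(x₀^D, …, x_m^D) ≠ 0`**: at `q0` the matrix is that of the isomorphism `φ_P` of Lemma 5.1
(injective by the uniqueness of the decomposition). [cite: Roy2013, proof of Theorem 5.2] -/
theorem aeval_q0_detPhi_ne_zero (hD : 1 ≤ D) : aeval (q0 m D) (detPhi hD) ≠ 0 := by
  classical
  rw [detPhi, AlgHom.map_det, AlgHom.mapMatrix_apply]
  intro hdet
  obtain ⟨v, hv0, hv⟩ := Matrix.exists_mulVec_eq_zero_iff.mpr hdet
  -- `G_v = 0`
  have hG : Gvec hD (q0 m D) v = 0 :=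
    eq_zero_of_forall_coeff (isHomogeneous_Gvec hD (q0 m D) v) fun γ => by
      rw [coeff_Gvec, hv, Pi.zero_apply]
  -- regroup `G_v = ∑_i (∑_k v_{ik} b_{ik}) x_i^D`
  set Qv : Fin (m + 1) → Nesterenko.Rx m :=
    fun i => ∑ k : Fin (dimE m D i), v (colEquiv hD ⟨i, k⟩) • bvec m D ⟨i, k⟩ with hQv
  have hG' : ∑ i, Qv i * purePow m D i = 0 := by
    rw [← hG, Gvec, ← Equiv.sum_comp (colEquiv hD)]
    simp only [Equiv.symm_apply_apply, Algebra.algebraMap_self, map_id, specForm_q0]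
    rw [Fintype.sum_sigma]
    refine Finset.sum_congr rfl fun i _ => ?_
    rw [hQv, purePow_fin, Finset.sum_mul]
    refine Finset.sum_congr rfl fun k _ => ?_
    rw [smul_mul_assoc]
  have hQmem : ∀ i : Fin (m + 1), Qv i ∈ decompE m D i := fun i =>
    Submodule.sum_mem _ fun k _ => Submodule.smul_mem _ _ (bvec_mem m D ⟨i, k⟩)
  obtain ⟨-, -, huniq⟩ := decompE_spec (m := m) hD
  have hu := (huniq 0 (Submodule.zero_mem _)).unique ⟨hQmem, hG'⟩
    ⟨fun j => Submodule.zero_mem _, by simp⟩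
  -- all coefficients vanish
  have hcoef : ∀ (i : Fin (m + 1)) (k : Fin (dimE m D i)), v (colEquiv hD ⟨i, k⟩) = 0 := by
    intro i
    have hi : Qv i = 0 := congrFun hu i
    have hsum : ∑ k : Fin (dimE m D i), v (colEquiv hD ⟨i, k⟩) • basisE m D i k = 0 := by
      apply Subtype.ext
      rw [Submodule.coe_sum, Submodule.coe_zero, ← hi, hQv]
      refine Finset.sum_congr rfl fun k _ => ?_
      rw [Submodule.coe_smul]
      rfl
    exact Fintype.linearIndependent_iff.mp (basisE m D i).linearIndependent _ hsum
  apply hv0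
  funext ρ
  have := hcoef ((colEquiv hD).symm ρ).1 ((colEquiv hD).symm ρ).2
  rw [Sigma.eta, Equiv.apply_symm_apply] at this
  exact this

variable {m D} in
/-- **`Φ ≠ 0`.** [cite: Roy2013, proof of Theorem 5.2] -/
theorem detPhi_ne_zero (hD : 1 ≤ D) : detPhi (m := m) hD ≠ 0 := fun h =>
  aeval_q0_detPhi_ne_zero hD (by rw [h, map_zero])

end Phi

/-! ## `Φ` is multihomogeneous of degree `d_i` in the block `u_i` -/

section BlockDegrees

variable (m D : ℕ)

/-- The entries of column `(j, k)` are linear in the block `u_j` and free of the other blocks.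
[cite: Roy2013, proof of Theorem 5.2] -/
theorem isWeightedHomogeneous_genEntry (i : Fin (m + 1)) (γ : Fin (m + 1) →₀ ℕ) (c : ColIdx m D) :
    IsWeightedHomogeneous (fun v : Fin (m + 1) × Fin (veroN m D + 1) => if v.1 = i then (1 : ℕ) else 0)
      (genEntry m D γ c) (if c.1 = i then 1 else 0) := by
  refine IsWeightedHomogeneous.sum _ _ _ fun j' _ => ?_
  have h := (isWeightedHomogeneous_C
    (fun v : Fin (m + 1) × Fin (veroN m D + 1) => if v.1 = i then (1 : ℕ) else 0)
    (coeff γ (bvec m D c * monomial (vexp m D j') 1))).mul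
    (isWeightedHomogeneous_X ℚ
      (fun v : Fin (m + 1) × Fin (veroN m D + 1) => if v.1 = i then (1 : ℕ) else 0) (c.1, j'))
  rwa [zero_add] at h

variable {m D} in
/-- `#{columns in block i} = d_i`. [folklore] -/
theorem sum_ite_colEquiv (hD : 1 ≤ D) (i : Fin (m + 1)) :
    ∑ ρ : MonoIdx m (nuD m D), (if ((colEquiv hD).symm ρ).1 = i then (1 : ℕ) else 0) = dimE m D i := by
  rw [← Equiv.sum_comp (colEquiv hD)]
  simp only [Equiv.symm_apply_apply]
  rw [Fintype.sum_sigma]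
  have h : ∀ x : Fin (m + 1), (∑ _y : Fin (dimE m D x), if x = i then (1 : ℕ) else 0) =
      if x = i then dimE m D x else 0 := by
    intro x
    rw [Finset.sum_const, Finset.card_univ, Fintype.card_fin, smul_eq_mul]
    split_ifs <;> simp
  exact (Finset.sum_congr rfl fun x _ => h x).trans (by rw [Finset.sum_ite_eq']; simp)

variable {m D} in
/-- **`Φ` is homogeneous of degree `d_i = dim E_i` in the block `u_i`** (each column of block `i`
is linear in `u_i`). [cite: Roy2013, proof of Theorem 5.2] -/
theorem isWeightedHomogeneous_detPhi (hD : 1 ≤ D) (i : Fin (m + 1)) :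
    IsWeightedHomogeneous (fun v : Fin (m + 1) × Fin (veroN m D + 1) => if v.1 = i then (1 : ℕ) else 0)
      (detPhi hD) (dimE m D i) := by
  classical
  set w : Fin (m + 1) × Fin (veroN m D + 1) → ℕ := fun v => if v.1 = i then (1 : ℕ) else 0 with hw
  rw [detPhi, Matrix.det_apply]
  refine IsWeightedHomogeneous.sum _ _ _ fun σ _ => ?_
  have hprod : IsWeightedHomogeneous w
      (∏ ρ, genMat hD (σ ρ) ρ)
      (∑ ρ : MonoIdx m (nuD m D), if ((colEquiv hD).symm ρ).1 = i then 1 else 0) :=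
    IsWeightedHomogeneous.prod _ _ _ fun ρ _ => isWeightedHomogeneous_genEntry m D i _ _
  rw [sum_ite_colEquiv hD i] at hprod
  rw [Units.smul_def]
  have hmem : (∏ ρ, genMat hD (σ ρ) ρ) ∈ weightedHomogeneousSubmodule ℚ w (dimE m D i) := hprod
  exact zsmul_mem hmem _

variable {m D} in
/-- **`deg_{u_i} Φ = d_i`**; in particular `deg_{u_m} Φ = D^m`. [cite: Roy2013, proof of Theorem 5.2] -/
theorem blockDeg_detPhi (hD : 1 ≤ D) (i : Fin (m + 1)) :
    Nesterenko.blockDeg (detPhi hD) i = dimE m D i :=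
  Nesterenko.blockDeg_eq_of_isWeightedHomogeneous (isWeightedHomogeneous_detPhi hD i)
    (detPhi_ne_zero hD)

end BlockDegrees

/-! ## `Res_D ∣ Φ`, through the generic point of `Res_D = 0` -/

section Divisibility

variable (m D : ℕ)

variable {m D} in
/-- **Zeros of `𝔙_D` over any field are Veronese points** (the argument of file XI over `ℂ`,
verbatim over a field `K ⊇ ℚ`): if `y ≠ 0` kills `𝔙_D` then `c • y = v_D(x)` with `x ≠ 0`, `c ≠ 0`.
[folklore] -/
theorem exists_veroPt_of_zerosK {K : Type*} [Field K] [Algebra ℚ K] (hD : 1 ≤ D)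
    {y : Fin (veroN m D + 1) → K} (hy0 : y ≠ 0) (hyI : ∀ P ∈ veroIdeal m D, aeval y P = 0) :
    ∃ x : Fin (m + 1) → K, x ≠ 0 ∧ ∃ c : K, c ≠ 0 ∧ ∀ i, c * y i = ∏ k, x k ^ vexp m D i k := by
  -- the pure powers
  set p : Fin (m + 1) → K := fun k => y (vidx m D (Finsupp.single k D) (Finsupp.degree_single k D))
    with hp
  have E1 : ∀ i, y i ^ D = ∏ k, p k ^ vexp m D i k := by
    intro i
    have h := hyI _ (pow_sub_prod_mem_veroIdeal i)
    simp only [map_sub, map_pow, map_prod, aeval_X, sub_eq_zero] at h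
    exact h
  obtain ⟨k, hk⟩ : ∃ k, p k ≠ 0 := by
    by_contra hall
    push Not at hall
    apply hy0
    funext i
    have h1 : ∃ k₀, vexp m D i k₀ ≠ 0 := by
      have hdeg : ∑ j, vexp m D i j = D := by
        rw [← Finsupp.degree_eq_sum]; exact degree_vexp m D i
      by_contra hnone
      push Not at hnone
      rw [Finset.sum_eq_zero fun j _ => hnone j] at hdeg
      omega
    obtain ⟨k₀, hk₀⟩ := h1
    have h2 : y i ^ D = 0 := by
      rw [E1 i]
      exact Finset.prod_eq_zero (Finset.mem_univ k₀) (by rw [hall k₀, zero_pow hk₀])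
    exact pow_eq_zero_iff (by omega) |>.mp h2
  refine ⟨fun j => y (shiftIdx hD k j), ?_, p k ^ (D - 1), pow_ne_zero _ hk, fun i => ?_⟩
  · intro hx
    have := congrFun hx k
    rw [Pi.zero_apply, shiftIdx_self hD k] at this
    exact hk this
  · have h := hyI _ (pow_mul_sub_prod_mem_veroIdeal hD k i)
    simp only [map_sub, map_mul, map_pow, map_prod, aeval_X, sub_eq_zero] at h
    exact h

/-- Evaluation of `ℚ[u]` through a ring homomorphism is `aeval` at the images of the variables
(for any `ℚ`-algebra structure on the target division ring). [folklore] -/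
theorem ringHom_eq_aeval {σ L : Type*} [Field L] [Algebra ℚ L] (φ : MvPolynomial σ ℚ →+* L)
    (G : MvPolynomial σ ℚ) : φ G = aeval (fun v => φ (X v)) G := by
  have key : φ = (aeval (R := ℚ) fun v => φ (X v) : MvPolynomial σ ℚ →ₐ[ℚ] L).toRingHom := by
    refine MvPolynomial.ringHom_ext (fun r => ?_) (fun v => ?_)
    · rw [AlgHom.toRingHom_eq_coe, RingHom.coe_coe, aeval_C, eq_ratCast (algebraMap ℚ L) r]
      exact eq_ratCast (φ.comp C) r
    · rw [AlgHom.toRingHom_eq_coe, RingHom.coe_coe, aeval_X]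
  exact congrFun (congrArg DFunLike.coe key) G

variable {m D} in
/-- **`Res_D` divides `Φ`** (`m ≥ 1`, `D ≥ 2`). At the generic point `ū` of the hypersurface
`Res_D = 0` (in an algebraic closure `L` of `Frac(ℚ[u]/(Res_D))`) the forms `Q_ū` have a common
zero `β ∈ ℙ^m(L)` (zeros theorem of file XI over `L`, via Nesterenko's theorem over algebraically
closed fields), so `φ_{Q_ū}` is not surjective (`x_k^ν`, `β_k ≠ 0`, is not of the form
`∑ A_j Q_j`), hence `Φ(ū) = det M_{Q_ū} = 0`, i.e. `Φ ∈ (Res_D)`. [cite: Roy2013, proof of Theorem 5.2] -/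
theorem resD_dvd_detPhi (hm : 1 ≤ m) (hD2 : 2 ≤ D) :
    resD m D ∣ detPhi (m := m) (D := D) (by omega) := by
  classical
  have hD : 1 ≤ D := by omega
  -- the prime `Res_D` and the generic point of `Res_D = 0`
  have hprime : Prime (resD m D) := (irreducible_resD hm hD2).prime
  haveI hI : (Ideal.span {resD m D}).IsPrime := (Ideal.span_singleton_prime hprime.ne_zero).mpr hprime
  set K₀ := Nesterenko.RU (m + 1) (veroN m D) ⧸ Ideal.span {resD m D} with hK₀
  set L := AlgebraicClosure (FractionRing K₀) with hL
  set φ : Nesterenko.RU (m + 1) (veroN m D) →+* L :=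
    (algebraMap K₀ L).comp (Ideal.Quotient.mk (Ideal.span {resD m D})) with hφ
  have hinjK : Function.Injective (algebraMap K₀ L) := by
    rw [IsScalarTower.algebraMap_eq K₀ (FractionRing K₀) L]
    exact (algebraMap (FractionRing K₀) L).injective.comp (IsFractionRing.injective K₀ (FractionRing K₀))
  have hφdvd : ∀ G, φ G = 0 → resD m D ∣ G := by
    intro G hG
    rw [hφ, RingHom.comp_apply, ← map_zero (algebraMap K₀ L)] at hG
    have h := hinjK hG
    rw [Ideal.Quotient.eq_zero_iff_mem, Ideal.mem_span_singleton] at h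
    exact h
  set u : Fin (m + 1) × Fin (veroN m D + 1) → L := fun v => φ (X v) with hu
  have hφu : ∀ G, φ G = aeval u G := fun G => ringHom_eq_aeval φ G
  -- `Res_D(ū) = 0`, so the forms `Q_ū` have a common zero `β`
  have hres : aeval u (resD m D) = 0 := by
    rw [← hφu, hφ, RingHom.comp_apply, Ideal.Quotient.eq_zero_iff_mem.mpr (Ideal.mem_span_singleton_self _),
      map_zero]
  change aeval u (Nesterenko.chowForm (veroIdeal m D) (m + 1)) = 0 at hres
  rw [Nesterenko.aeval_chowForm_eq_zero_iff_of_isAlgClosed (veroIdeal_isHomogeneous hD)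
    (isPrincipal_elimIdeal_veroIdeal hm hD2)] at hres
  obtain ⟨y, hy0, hyI, hyu⟩ := hres
  obtain ⟨x, hx0, c, hc, hcy⟩ := exists_veroPt_of_zerosK hD hy0 hyI
  have hQ : ∀ i, aeval x (specForm m D u i) = 0 := by
    intro i
    rw [aeval_specForm]
    calc ∑ j', u (i, j') * ∏ k, x k ^ vexp m D j' k = ∑ j', c * (u (i, j') * y j') := by
          refine Finset.sum_congr rfl fun j' _ => ?_
          rw [← hcy j']
          ring
      _ = c * ∑ j', u (i, j') * y j' := by rw [Finset.mul_sum]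
      _ = 0 := by rw [hyu i, mul_zero]
  -- hence `Φ(ū) = 0`
  apply hφdvd
  rw [hφu, detPhi, AlgHom.map_det, AlgHom.mapMatrix_apply]
  by_contra hdet
  have hunit : IsUnit ((genMat hD).map (aeval u)) :=
    (Matrix.isUnit_iff_isUnit_det _).mpr (Ne.isUnit hdet)
  have hsurj := Matrix.mulVec_surjective_iff_isUnit.mpr hunit
  obtain ⟨k, hk⟩ := Function.ne_iff.mp hx0
  -- the coefficient vector of `x_k^ν`
  obtain ⟨v, hv⟩ := hsurj fun γ => if γ.1 = Finsupp.single k (nuD m D) then 1 else 0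
  have hG : Gvec hD u v = X k ^ nuD m D := by
    rw [← sub_eq_zero]
    refine eq_zero_of_forall_coeff ((isHomogeneous_Gvec hD u v).sub (isHomogeneous_X_pow _ _)) fun γ => ?_
    rw [coeff_sub, coeff_Gvec, hv, X_pow_eq_monomial, coeff_monomial, sub_eq_zero]
    dsimp only
    by_cases h : γ.1 = Finsupp.single k (nuD m D)
    · rw [if_pos h, if_pos h.symm]
    · rw [if_neg h, if_neg (Ne.symm h)]
  have h0 := aeval_Gvec_eq_zero hD hQ v
  rw [hG, map_pow, aeval_X] at h0
  exact hk (pow_eq_zero_iff (by have := (nuD_spec (m := m) hD).2; omega) |>.mp h0)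

variable {m D} in
/-- **The upper bound `deg 𝔙_D ≤ D^m`**: `Res_D ∣ Φ`, both are homogeneous in the block `u_m`, of
degrees `deg 𝔙_D` and `d_m = D^m`. [cite: Roy2013, proof of Theorem 5.2] -/
theorem ideg_veroIdeal_le (hm : 1 ≤ m) (hD2 : 2 ≤ D) :
    Nesterenko.ideg (veroIdeal m D) (m + 1) ≤ D ^ m := by
  classical
  have hD : 1 ≤ D := by omega
  obtain ⟨Ψ, hΨ⟩ := resD_dvd_detPhi hm hD2
  set w : Fin (m + 1) × Fin (veroN m D + 1) → ℕ := fun v => if v.1 = Fin.last m then 1 else 0 with hw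
  have hres : IsWeightedHomogeneous w (resD m D) (Nesterenko.ideg (veroIdeal m D) (m + 1)) :=
    Nesterenko.chowForm_isWeightedHomogeneous (veroIdeal m D) (Nat.succ_pos m) (Fin.last m)
  have hphi : IsWeightedHomogeneous w (detPhi hD) (D ^ m) := by
    rw [← dimE_last hD]
    exact isWeightedHomogeneous_detPhi hD (Fin.last m)
  by_contra hlt
  rw [not_le] at hlt
  -- a monomial of `Φ = Res_D Ψ` is a product of monomials of `Res_D` and `Ψ`
  obtain ⟨e, he⟩ := exists_coeff_ne_zero (detPhi_ne_zero (m := m) hD)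
  have hwe : Finsupp.weight w e = D ^ m := hphi he
  rw [hΨ, coeff_mul] at he
  obtain ⟨⟨a, b⟩, hab, hne⟩ := Finset.exists_ne_zero_of_sum_ne_zero he
  replace hab := Finset.HasAntidiagonal.mem_antidiagonal.mp hab
  have hwa : Finsupp.weight w a = Nesterenko.ideg (veroIdeal m D) (m + 1) :=
    hres (left_ne_zero_of_mul hne)
  have hle : Finsupp.weight w a ≤ Finsupp.weight w e := by
    rw [← hab, map_add]
    exact Nat.le_add_right _ _
  omega

variable {m D} in
/-- **`deg 𝔙_D = D^m`**: the resultant `Res_D` of `m + 1` forms of degree `D` in `m + 1` variables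
is homogeneous of degree `D^m` in (the coefficients of) each form (`m ≥ 1`, `D ≥ 2`).
[cite: Roy2013, proof of Theorem 5.2] -/
theorem ideg_veroIdeal_eq (hm : 1 ≤ m) (hD2 : 2 ≤ D) :
    Nesterenko.ideg (veroIdeal m D) (m + 1) = D ^ m :=
  le_antisymm (ideg_veroIdeal_le hm hD2) (pow_le_ideg_veroIdeal hm hD2)

variable {m D} in
/-- **`deg_{u_i} Res_D = D^m` for every block `u_i`.** [cite: Roy2013, proof of Theorem 5.2] -/
theorem blockDeg_resD_eq (hm : 1 ≤ m) (hD2 : 2 ≤ D) (i : Fin (m + 1)) :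
    Nesterenko.blockDeg (resD m D) i = D ^ m := by
  rw [blockDeg_resD hm hD2, ideg_veroIdeal_eq hm hD2]

end Divisibility

end NguyenRoy

end Literature.NumberTheory.Transcendental
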